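import Summits.CriticalPhenomena.SAWScalingLimit.Theorems.SAWDevelopingMapHexConjectureKPDefs
import Mathlib.Analysis.SpecialFunctions.Pow.Real
import Mathlib.Analysis.Convex.SpecificFunctions.Basic
import HarnessLib

/-!
# Crux `HexConjecture` (stmt-CriticalPhenomena-0808), line `root-locality-replaces-loewner`:
Krachun–Panagiotis' "purely analytical lemma" — the recurrence inequality plus summability of the
window masses along geometric scales force POLYNOMIAL DECAY

Landing target:
`Summits/CriticalPhenomena/SAWScalingLimit/Theorems/SAWDevelopingMapHexConjectureKPDecay.lean`
(`--supports stmt-CriticalPhenomena-0808`; registered stub `stub_kp_decay`).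

This is [KP, Lemma 3.4] with general constants, a statement about an abstract positive
non-increasing sequence `a` (KP's `D`) and nonnegative window masses `W T`
(KP's `Σ_{k=T}^{21T} G_k`):
* the RECURRENCE `T⁴ · a(9T)⁵ ≤ Cbig · (Σ_{i ≤ 3T} a i)⁴ · W T` (`T ≥ 1`; KP's (12)), and
* the WINDOW SUMMABILITY `Σ_{j < B} W(22ʲ T₀) ≤ κ · a(T₀ - 1)` (all `T₀ ≥ 1`, `B`; KP: the windows
  `[22ʲT₀, 21·22ʲT₀]` are disjoint and `Σ_{k ≥ T₀} G_k ≤ 2 D_{2T₀-1}`)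
imply `a T ≤ C · T^(-ε)` for some `ε > 0` and all `T ≥ 1`.

PROOF (KP's induction with the constants generalised).  Fix a number of windows `B` with
`4·9⁴·Cbig·κ ≤ B`, put `ε := 1/(100 B)`, `A := 2·a 0`, `b := 22^B`, `K_s := b^s`.  We show
`P(s) : a(K_s) ≤ A · K_{s+1}^(-ε)` for all `s` by strong induction; by monotonicity this yields
`a T ≤ A · T^(-ε)` for every `T ≥ 1` (`kpDecay_allT`: `K_r ≤ T < K_{r+1}`).  For the step
`s = r + 1` put `T₀ := K_r`; pigeonhole on the window sum (`kpDecay_pigeon`) gives `j < B` with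
`W(22ʲT₀) ≤ κ·a(T₀-1)/B`; the recurrence at `T := 22ʲ T₀`, `a(K_s) ≤ a(9T)` (`9T ≤ b·T₀ = K_s`),
the induction hypothesis below `K_s` in the two forms `Σ_{i ≤ 3T} a i ≤ 9A·T^(1-ε)`
(`kpDecay_sum`, via the power sum `Σ_{i ≤ n} i^(-ε) ≤ 2 n^(1-ε)`, `kpDecay_powsum`, proved by a
Bernoulli telescoping) and `a(T₀-1) ≤ 2A·T₀^(-ε)` (`kpDecay_prev`) combine (`kpDecay_alg`) to
`a(K_s)⁵ ≤ (2·9⁴·Cbig·κ/B) · A⁵ · T₀^(-5ε) ≤ ½ · A⁵ · T₀^(-5ε) ≤ (A·u·T₀^(-ε))⁵` with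
`u := (b²)^(-ε) = 22^(-1/50)` (`u⁵ = 22^(-1/10) ≥ ½`, `kpDecay_num`), i.e.
`a(K_s) ≤ A·K_{s+1}^(-ε)`.
Sources: Krachun–Panagiotis, arXiv:2310.17299 = Ann. Probab. 2026, Lemma 3.4 and its proof
(p. 16–17).
-/

noncomputable section

open Finset

namespace Summit.CriticalPhenomena.SAWScalingLimit.Theorems.HexConjecture.RootLocality

/-- **Bernoulli telescoping**: for `0 ≤ ε ≤ 1` and real `m ≥ 1`,
`(1 - ε) · m^(-ε) ≤ m^(1-ε) - (m-1)^(1-ε)` (the secant of the concave `x ↦ x^(1-ε)` over `[m-1, m]`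
dominates the derivative at `m`). [folklore] -/
theorem kpDecay_rpow_telescope {ε : ℝ} (hε0 : 0 ≤ ε) (hε1 : ε ≤ 1) {m : ℝ} (hm : 1 ≤ m) :
    (1 - ε) * m ^ (-ε) ≤ m ^ (1 - ε) - (m - 1) ^ (1 - ε) := by
  have hm0 : 0 < m := by linarith
  have hs : (-1 : ℝ) ≤ -1 / m := by
    rw [neg_div, neg_le_neg_iff, div_le_one hm0]; exact hm
  have hs0 : (0 : ℝ) ≤ 1 + -1 / m := by linarith
  have hB : (1 + -1 / m) ^ (1 - ε) ≤ 1 + (1 - ε) * (-1 / m) :=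
    rpow_one_add_le_one_add_mul_self hs (by linarith) (by linarith)
  have e1 : m - 1 = m * (1 + -1 / m) := by field_simp; ring
  have e3 : m ^ (1 - ε) = m * m ^ (-ε) := by
    rw [sub_eq_add_neg, Real.rpow_add hm0, Real.rpow_one]
  have key : (m - 1) ^ (1 - ε) ≤ m * m ^ (-ε) - (1 - ε) * m ^ (-ε) := by
    calc (m - 1) ^ (1 - ε) = m ^ (1 - ε) * (1 + -1 / m) ^ (1 - ε) := by
          rw [e1, Real.mul_rpow hm0.le hs0]
      _ ≤ m ^ (1 - ε) * (1 + (1 - ε) * (-1 / m)) :=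
          mul_le_mul_of_nonneg_left hB (Real.rpow_nonneg hm0.le _)
      _ = m * m ^ (-ε) - (1 - ε) * m ^ (-ε) := by rw [e3]; field_simp; ring
  rw [e3]; linarith

/-- **The power sum** `Σ_{i=1}^{n} i^(-ε) ≤ 2 · n^(1-ε)` for `0 < ε ≤ 1/2`
(integral comparison, here via `kpDecay_rpow_telescope`). [folklore] -/
theorem kpDecay_powsum {ε : ℝ} (hε0 : 0 < ε) (hε1 : ε ≤ 1 / 2) (n : ℕ) :
    ∑ i ∈ range n, ((i : ℝ) + 1) ^ (-ε) ≤ 2 * (n : ℝ) ^ (1 - ε) := by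
  have hS : 0 ≤ ∑ i ∈ range n, ((i : ℝ) + 1) ^ (-ε) :=
    sum_nonneg fun i _ => Real.rpow_nonneg (by positivity) _
  have tele := Finset.sum_range_sub (fun k : ℕ => (k : ℝ) ^ (1 - ε)) n
  push_cast at tele
  rw [Real.zero_rpow (by linarith : (1 : ℝ) - ε ≠ 0), sub_zero] at tele
  have h2 : (1 - ε) * ∑ i ∈ range n, ((i : ℝ) + 1) ^ (-ε) ≤ (n : ℝ) ^ (1 - ε) := by
    rw [mul_sum, ← tele]
    refine sum_le_sum fun i _ => ?_
    have h := kpDecay_rpow_telescope hε0.le (by linarith) (m := (i : ℝ) + 1)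
      (by linarith [(i.cast_nonneg : (0 : ℝ) ≤ i)])
    rwa [add_sub_cancel_right] at h
  have h3 : ε * ∑ i ∈ range n, ((i : ℝ) + 1) ^ (-ε) ≤
      1 / 2 * ∑ i ∈ range n, ((i : ℝ) + 1) ^ (-ε) := mul_le_mul_of_nonneg_right hε1 hS
  linarith

/-- Numerics: `22^t ≥ 1/2` for `t ≥ -1/10` (as `22 ≤ 2¹⁰`). [folklore] -/
theorem kpDecay_num (t : ℝ) (ht : -1 / 10 ≤ t) : 1 / 2 ≤ (22 : ℝ) ^ t := by
  have h1 : (22 : ℝ) ^ (-(1 / 10 : ℝ)) ≤ 22 ^ t :=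
    Real.rpow_le_rpow_of_exponent_le (by norm_num) (by linarith)
  have h3 : (22 : ℝ) ^ ((1 : ℝ) / 10) ≤ 2 := by
    have e : (2 : ℝ) = (2 ^ 10 : ℝ) ^ ((10 : ℕ) : ℝ)⁻¹ :=
      (Real.pow_rpow_inv_natCast (by norm_num) (by norm_num)).symm
    have e' : ((10 : ℕ) : ℝ)⁻¹ = (1 : ℝ) / 10 := by norm_num
    rw [e, e']
    exact Real.rpow_le_rpow (by norm_num) (by norm_num) (by norm_num)
  have h2 : (1 / 2 : ℝ) ≤ 22 ^ (-(1 / 10 : ℝ)) := by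
    rw [Real.rpow_neg (by norm_num), one_div]
    exact inv_anti₀ (by positivity) h3
  exact h2.trans h1

/-- **From the scales `K_r = b^r` to all `T`**: if `a` is non-increasing and
`a(b^r) ≤ A·(b^(r+1))^(-ε)` for all `r < s`, then `a T ≤ A·T^(-ε)` for `1 ≤ T < b^s`
(take `r := log_b T`, so `b^r ≤ T < b^(r+1)`).
[cite: KrachunPanagiotis2026, Lemma 3.4 (proof, (13))] -/
theorem kpDecay_allT {a : ℕ → ℝ} (ha : Antitone a) {b : ℕ} (hb : 1 < b) {A ε : ℝ} (hA : 0 ≤ A)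
    (hε : 0 ≤ ε) {s : ℕ} (hP : ∀ r < s, a (b ^ r) ≤ A * ((b ^ (r + 1) : ℕ) : ℝ) ^ (-ε)) :
    ∀ T : ℕ, 1 ≤ T → T < b ^ s → a T ≤ A * (T : ℝ) ^ (-ε) := by
  intro T hT hTs
  have h1 : b ^ Nat.log b T ≤ T := Nat.pow_log_le_self b (by omega)
  have h2 : T < b ^ (Nat.log b T + 1) := Nat.lt_pow_succ_log_self hb T
  have hrs : Nat.log b T < s := by
    by_contra h
    have : b ^ s ≤ b ^ Nat.log b T := Nat.pow_le_pow_right (by omega) (by omega)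
    omega
  calc a T ≤ a (b ^ Nat.log b T) := ha h1
    _ ≤ A * ((b ^ (Nat.log b T + 1) : ℕ) : ℝ) ^ (-ε) := hP _ hrs
    _ ≤ A * (T : ℝ) ^ (-ε) := by
        refine mul_le_mul_of_nonneg_left ?_ hA
        exact Real.rpow_le_rpow_of_nonpos (by exact_mod_cast (show 0 < T by omega))
          (by exact_mod_cast h2.le) (by linarith)

/-- **Pigeonhole on the windows**: if `Σ_{j<B} W(22ʲT₀) ≤ c` and `B ≥ 1`, some `j < B` has
`W(22ʲT₀) ≤ c/B`. [cite: KrachunPanagiotis2026, Lemma 3.4 (proof, choice of j₀)] -/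
theorem kpDecay_pigeon {W : ℕ → ℝ} {B T₀ : ℕ} (hB : 1 ≤ B) {c : ℝ}
    (h : ∑ j ∈ range B, W (22 ^ j * T₀) ≤ c) :
    ∃ j, j < B ∧ W (22 ^ j * T₀) ≤ c / B := by
  have hne : (range B).Nonempty := nonempty_range_iff.2 (by omega)
  have hB0 : (B : ℝ) ≠ 0 := Nat.cast_ne_zero.2 (by omega)
  have h' : ∑ j ∈ range B, W (22 ^ j * T₀) ≤ ∑ _j ∈ range B, c / B := by
    rw [sum_const, card_range, nsmul_eq_mul, mul_div_cancel₀ c hB0]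
    exact h
  obtain ⟨j, hj, hle⟩ := exists_le_of_sum_le hne h'
  exact ⟨j, mem_range.1 hj, hle⟩

/-- **The induction hypothesis one step below the scale**: `a(b^r - 1) ≤ 2A·(b^r)^(-ε)`
(for `r = 0` this is `a 0 ≤ 2A`; for `r ≥ 1`, `(b^r - 1)^(-ε) ≤ (b^r/2)^(-ε) ≤ 2·(b^r)^(-ε)`).
[cite: KrachunPanagiotis2026, Lemma 3.4 (proof, bound on D_{T₀})] -/
theorem kpDecay_prev {a : ℕ → ℝ} {A ε : ℝ} (hA : a 0 ≤ A) (hA0 : 0 ≤ A) (hε0 : 0 ≤ ε)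
    (hε1 : ε ≤ 1) {b r : ℕ} (hb : 2 ≤ b)
    (IH : ∀ T : ℕ, 1 ≤ T → T < b ^ (r + 1) → a T ≤ A * (T : ℝ) ^ (-ε)) :
    a (b ^ r - 1) ≤ 2 * A * ((b ^ r : ℕ) : ℝ) ^ (-ε) := by
  rcases Nat.eq_zero_or_pos r with rfl | hr
  · simp only [pow_zero, Nat.sub_self, Nat.cast_one, Real.one_rpow]
    linarith
  have hN : 2 ≤ b ^ r := le_trans hb (Nat.le_self_pow hr.ne' b)
  have hlt : b ^ r - 1 < b ^ (r + 1) :=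
    lt_of_lt_of_le (Nat.sub_lt (by omega) one_pos) (Nat.pow_le_pow_right (by omega) (by omega))
  have h1 := IH (b ^ r - 1) (by omega) hlt
  have hNr : (2 : ℝ) ≤ ((b ^ r : ℕ) : ℝ) := by exact_mod_cast hN
  have hcast : ((b ^ r - 1 : ℕ) : ℝ) = ((b ^ r : ℕ) : ℝ) - 1 := by
    rw [Nat.cast_sub (by omega : 1 ≤ b ^ r), Nat.cast_one]
  have key : (((b ^ r : ℕ) : ℝ) - 1) ^ (-ε) ≤ 2 * ((b ^ r : ℕ) : ℝ) ^ (-ε) := by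
    calc (((b ^ r : ℕ) : ℝ) - 1) ^ (-ε) ≤ (((b ^ r : ℕ) : ℝ) / 2) ^ (-ε) :=
          Real.rpow_le_rpow_of_nonpos (by linarith) (by linarith) (by linarith)
      _ = ((b ^ r : ℕ) : ℝ) ^ (-ε) * 2 ^ ε := by
          rw [Real.div_rpow (by linarith) (by norm_num), Real.rpow_neg (by norm_num : (0 : ℝ) ≤ 2),
            div_inv_eq_mul]
      _ ≤ ((b ^ r : ℕ) : ℝ) ^ (-ε) * 2 := by
          refine mul_le_mul_of_nonneg_left ?_ (Real.rpow_nonneg (by linarith) _)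
          calc (2 : ℝ) ^ ε ≤ 2 ^ (1 : ℝ) := Real.rpow_le_rpow_of_exponent_le (by norm_num) hε1
            _ = 2 := Real.rpow_one 2
      _ = 2 * ((b ^ r : ℕ) : ℝ) ^ (-ε) := by ring
  calc a (b ^ r - 1) ≤ A * ((b ^ r - 1 : ℕ) : ℝ) ^ (-ε) := h1
    _ = A * (((b ^ r : ℕ) : ℝ) - 1) ^ (-ε) := by rw [hcast]
    _ ≤ A * (2 * ((b ^ r : ℕ) : ℝ) ^ (-ε)) := mul_le_mul_of_nonneg_left key hA0
    _ = 2 * A * ((b ^ r : ℕ) : ℝ) ^ (-ε) := by ring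

/-- **The induction hypothesis summed**: if `a i ≤ A·i^(-ε)` for `1 ≤ i < N` and `3T < N`,
then `Σ_{i ≤ 3T} a i ≤ 9A · T^(1-ε)` (`a 0 ≤ A`, `0 < ε ≤ 1/2`, `T ≥ 1`).
[cite: KrachunPanagiotis2026, Lemma 3.4 (proof, bound on Σ D_i)] -/
theorem kpDecay_sum {a : ℕ → ℝ} {A ε : ℝ} (hA : a 0 ≤ A) (hA0 : 0 ≤ A) (hε0 : 0 < ε)
    (hε1 : ε ≤ 1 / 2) {N T : ℕ} (hT : 1 ≤ T) (h3T : 3 * T < N)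
    (IH : ∀ i : ℕ, 1 ≤ i → i < N → a i ≤ A * (i : ℝ) ^ (-ε)) :
    ∑ i ∈ range (3 * T + 1), a i ≤ 9 * A * ((T : ℝ) * (T : ℝ) ^ (-ε)) := by
  rw [sum_range_succ']
  have h1 : ∑ i ∈ range (3 * T), a (i + 1) ≤ A * (2 * ((3 * T : ℕ) : ℝ) ^ (1 - ε)) := by
    calc ∑ i ∈ range (3 * T), a (i + 1) ≤ ∑ i ∈ range (3 * T), A * ((i : ℝ) + 1) ^ (-ε) := by
          refine sum_le_sum fun i hi => ?_
          have hi' := mem_range.1 hi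
          have := IH (i + 1) (by omega) (by omega)
          push_cast at this
          exact this
      _ = A * ∑ i ∈ range (3 * T), ((i : ℝ) + 1) ^ (-ε) := by rw [mul_sum]
      _ ≤ A * (2 * ((3 * T : ℕ) : ℝ) ^ (1 - ε)) :=
          mul_le_mul_of_nonneg_left (kpDecay_powsum hε0 hε1 (3 * T)) hA0
  have hTr : (1 : ℝ) ≤ T := by exact_mod_cast hT
  have hT0 : (0 : ℝ) < T := by linarith
  have e2 : (T : ℝ) ^ (1 - ε) = T * (T : ℝ) ^ (-ε) := by
    rw [sub_eq_add_neg, Real.rpow_add hT0, Real.rpow_one]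
  have h2 : ((3 * T : ℕ) : ℝ) ^ (1 - ε) ≤ 3 * ((T : ℝ) * (T : ℝ) ^ (-ε)) := by
    push_cast
    rw [Real.mul_rpow (by norm_num) hT0.le, ← e2]
    have e1 : (3 : ℝ) ^ (1 - ε) ≤ 3 := by
      calc (3 : ℝ) ^ (1 - ε) ≤ 3 ^ (1 : ℝ) :=
            Real.rpow_le_rpow_of_exponent_le (by norm_num) (by linarith)
        _ = 3 := Real.rpow_one 3
    exact mul_le_mul_of_nonneg_right e1 (Real.rpow_nonneg hT0.le _)
  have h3 : (1 : ℝ) ≤ (T : ℝ) * (T : ℝ) ^ (-ε) := by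
    rw [← e2]; exact Real.one_le_rpow hTr (by linarith)
  have h4 : a 0 ≤ A * ((T : ℝ) * (T : ℝ) ^ (-ε)) := hA.trans (le_mul_of_one_le_right hA0 h3)
  have h5 : 0 ≤ A * ((T : ℝ) * (T : ℝ) ^ (-ε)) := by positivity
  have h6 : ∑ i ∈ range (3 * T), a (i + 1) ≤ A * (2 * (3 * ((T : ℝ) * (T : ℝ) ^ (-ε)))) :=
    h1.trans (mul_le_mul_of_nonneg_left (by linarith) hA0)
  linarith

/-- **The real-number algebra of the induction step**: from the recurrence `Tr⁴·x⁵ ≤ Cb·S⁴·w`,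
`S ≤ 9A·Tr·p`, `w ≤ κ·d/Bn`, `d ≤ 2A·q`, `p ≤ q`, `2·9⁴·Cb·κ/Bn ≤ ½ ≤ u⁵` and `y ≤ x` one gets
`y ≤ A·u·q`. [cite: KrachunPanagiotis2026, Lemma 3.4 (proof, final display)] -/
theorem kpDecay_alg {Tr p q A Cb κ Bn S w d x y u : ℝ}
    (hTr : 0 < Tr) (hp : 0 ≤ p) (hpq : p ≤ q) (hA : 0 ≤ A) (hCb : 0 ≤ Cb) (hκ : 0 ≤ κ)
    (hBn : 0 < Bn) (hS0 : 0 ≤ S) (hS : S ≤ 9 * A * (Tr * p))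
    (hw0 : 0 ≤ w) (hw : w ≤ κ * d / Bn) (hd : d ≤ 2 * A * q)
    (hrec : Tr ^ 4 * x ^ 5 ≤ Cb * S ^ 4 * w)
    (hc : 2 * 9 ^ 4 * Cb * κ / Bn ≤ 1 / 2) (hu0 : 0 ≤ u) (hu : 1 / 2 ≤ u ^ 5)
    (hy0 : 0 ≤ y) (hyx : y ≤ x) :
    y ≤ A * u * q := by
  have hq : 0 ≤ q := hp.trans hpq
  have h1 : S ^ 4 ≤ (9 * A * (Tr * p)) ^ 4 := pow_le_pow_left₀ hS0 hS 4
  have h2 : w ≤ κ * (2 * A * q) / Bn :=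
    hw.trans (div_le_div_of_nonneg_right (mul_le_mul_of_nonneg_left hd hκ) hBn.le)
  have h3 : Tr ^ 4 * x ^ 5 ≤ Cb * (9 * A * (Tr * p)) ^ 4 * (κ * (2 * A * q) / Bn) := by
    calc Tr ^ 4 * x ^ 5 ≤ Cb * S ^ 4 * w := hrec
      _ ≤ Cb * (9 * A * (Tr * p)) ^ 4 * w :=
          mul_le_mul_of_nonneg_right (mul_le_mul_of_nonneg_left h1 hCb) hw0
      _ ≤ Cb * (9 * A * (Tr * p)) ^ 4 * (κ * (2 * A * q) / Bn) :=
          mul_le_mul_of_nonneg_left h2 (by positivity)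
  have h4 : x ^ 5 ≤ 2 * 9 ^ 4 * Cb * κ / Bn * A ^ 5 * (p ^ 4 * q) := by
    have e : Cb * (9 * A * (Tr * p)) ^ 4 * (κ * (2 * A * q) / Bn) =
        Tr ^ 4 * (2 * 9 ^ 4 * Cb * κ / Bn * A ^ 5 * (p ^ 4 * q)) := by ring
    rw [e] at h3
    exact le_of_mul_le_mul_left h3 (by positivity)
  have h5 : p ^ 4 * q ≤ q ^ 5 := by
    calc p ^ 4 * q ≤ q ^ 4 * q := mul_le_mul_of_nonneg_right (pow_le_pow_left₀ hp hpq 4) hq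
      _ = q ^ 5 := by ring
  have hc0 : 0 ≤ 2 * 9 ^ 4 * Cb * κ / Bn := by positivity
  have h6 : x ^ 5 ≤ (A * u * q) ^ 5 := by
    calc x ^ 5 ≤ 2 * 9 ^ 4 * Cb * κ / Bn * A ^ 5 * (p ^ 4 * q) := h4
      _ ≤ 1 / 2 * A ^ 5 * q ^ 5 :=
          mul_le_mul (mul_le_mul_of_nonneg_right hc (pow_nonneg hA 5)) h5 (by positivity)
            (by positivity)
      _ ≤ u ^ 5 * A ^ 5 * q ^ 5 :=
          mul_le_mul_of_nonneg_right (mul_le_mul_of_nonneg_right hu (pow_nonneg hA 5))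
            (pow_nonneg hq 5)
      _ = (A * u * q) ^ 5 := by ring
  have h7 : y ^ 5 ≤ (A * u * q) ^ 5 := (pow_le_pow_left₀ hy0 hyx 5).trans h6
  exact (pow_le_pow_iff_left₀ hy0 (by positivity) (by norm_num)).1 h7

/-- **The induction step of [KP, Lemma 3.4]**: with `b = 22^B`, `4·9⁴·Cbig·κ ≤ B`,
`0 < ε ≤ 1/2`, `a 0 ≤ A`, `½ ≤ u⁵`, the induction hypothesis `a T ≤ A·T^(-ε)` for all
`1 ≤ T < b^(r+1)` gives `a(b^(r+1)) ≤ A·u·(b^r)^(-ε)`.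
[cite: KrachunPanagiotis2026, Lemma 3.4 (proof, induction step)] -/
theorem kpDecay_step {a W : ℕ → ℝ} {Cbig κ : ℝ} (ha : ∀ n : ℕ, 0 < a n) (hmono : Antitone a)
    (hC : 0 < Cbig) (hκ : 0 < κ) (hW : ∀ T : ℕ, 1 ≤ T → 0 ≤ W T)
    (hrec : ∀ T : ℕ, 1 ≤ T →
      (T : ℝ) ^ 4 * a (9 * T) ^ 5 ≤ Cbig * (∑ i ∈ Finset.range (3 * T + 1), a i) ^ 4 * W T)
    (hwin : ∀ T₀ : ℕ, 1 ≤ T₀ → ∀ B : ℕ, ∑ j ∈ Finset.range B, W (22 ^ j * T₀) ≤ κ * a (T₀ - 1))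
    {B b : ℕ} (hbB : 22 ^ B = b) (hB1 : 1 ≤ B) (hB : 4 * 9 ^ 4 * Cbig * κ ≤ (B : ℝ))
    {ε A u : ℝ} (hε0 : 0 < ε) (hε1 : ε ≤ 1 / 2) (hA : a 0 ≤ A) (hu0 : 0 ≤ u)
    (hu : 1 / 2 ≤ u ^ 5) {r : ℕ}
    (IH : ∀ T : ℕ, 1 ≤ T → T < b ^ (r + 1) → a T ≤ A * (T : ℝ) ^ (-ε)) :
    a (b ^ (r + 1)) ≤ A * u * ((b ^ r : ℕ) : ℝ) ^ (-ε) := by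
  have hb22 : 22 ≤ b := by rw [← hbB]; exact Nat.le_self_pow (by omega) 22
  have hT₀1 : 1 ≤ b ^ r := Nat.one_le_pow _ _ (by omega)
  have hA0 : 0 ≤ A := (ha 0).le.trans hA
  -- pigeonhole: a cheap window `j < B`
  obtain ⟨j, hjB, hWj⟩ := kpDecay_pigeon hB1 (hwin (b ^ r) hT₀1 B)
  have hT1 : 1 ≤ 22 ^ j * b ^ r := Nat.succ_le_of_lt (Nat.mul_pos (Nat.pow_pos (by norm_num)) hT₀1)
  -- `9T ≤ b^(r+1)`, hence `a(b^(r+1)) ≤ a(9T)` and `3T < b^(r+1)`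
  have h9 : 9 * (22 ^ j * b ^ r) ≤ b ^ (r + 1) := by
    have h1 : 9 * 22 ^ j ≤ 22 ^ B := by
      calc 9 * 22 ^ j ≤ 22 * 22 ^ j := Nat.mul_le_mul_right _ (by norm_num)
        _ = 22 ^ (j + 1) := by ring
        _ ≤ 22 ^ B := Nat.pow_le_pow_right (by norm_num) hjB
    calc 9 * (22 ^ j * b ^ r) = 9 * 22 ^ j * b ^ r := by ring
      _ ≤ 22 ^ B * b ^ r := Nat.mul_le_mul_right _ h1
      _ = b ^ (r + 1) := by rw [hbB]; ring
  have hyx : a (b ^ (r + 1)) ≤ a (9 * (22 ^ j * b ^ r)) := hmono h9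
  have h3T : 3 * (22 ^ j * b ^ r) < b ^ (r + 1) := by omega
  -- the two uses of the induction hypothesis
  have hS := kpDecay_sum hA hA0 hε0 hε1 hT1 h3T IH
  have hprev := kpDecay_prev hA hA0 hε0.le (by linarith) (r := r) (show 2 ≤ b by omega) IH
  -- real-number bookkeeping
  have hTr0 : (0 : ℝ) < ((22 ^ j * b ^ r : ℕ) : ℝ) := by exact_mod_cast hT1
  have hTT₀ : ((b ^ r : ℕ) : ℝ) ≤ ((22 ^ j * b ^ r : ℕ) : ℝ) := by
    exact_mod_cast Nat.le_mul_of_pos_left _ (Nat.pow_pos (by norm_num))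
  have hpq : ((22 ^ j * b ^ r : ℕ) : ℝ) ^ (-ε) ≤ ((b ^ r : ℕ) : ℝ) ^ (-ε) :=
    Real.rpow_le_rpow_of_nonpos (by exact_mod_cast hT₀1) hTT₀ (by linarith)
  have hBr : (0 : ℝ) < B := by exact_mod_cast hB1
  have hc : 2 * 9 ^ 4 * Cbig * κ / B ≤ 1 / 2 := by
    rw [div_le_iff₀ hBr]; linarith
  have hS0 : 0 ≤ ∑ i ∈ Finset.range (3 * (22 ^ j * b ^ r) + 1), a i :=
    sum_nonneg fun i _ => (ha i).le
  exact kpDecay_alg hTr0 (Real.rpow_nonneg hTr0.le _) hpq hA0 hC.le hκ.le hBr hS0 hS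
    (hW _ hT1) hWj hprev (hrec _ hT1) hc hu0 hu (ha _).le hyx

/-- **Krachun–Panagiotis, Lemma 3.4 (general constants)**: a positive non-increasing sequence `a`
satisfying the recurrence `T⁴·a(9T)⁵ ≤ Cbig·(Σ_{i ≤ 3T} a i)⁴·W T` (`T ≥ 1`) with nonnegative
window masses summable along geometric scales, `Σ_{j<B} W(22ʲT₀) ≤ κ·a(T₀-1)`, decays
polynomially: `a T ≤ C·T^(-ε)` for some `ε > 0`. [cite: KrachunPanagiotis2026, Lemma 3.4] -/
theorem stub_kp_decay : ∀ (a W : ℕ → ℝ) (Cbig κ : ℝ), (∀ n : ℕ, 0 < a n) → Antitone a → 0 < Cbig → 0 < κ → (∀ T : ℕ, 1 ≤ T → 0 ≤ W T) → (∀ T : ℕ, 1 ≤ T → (T : ℝ) ^ 4 * a (9 * T) ^ 5 ≤ Cbig * (∑ i ∈ Finset.range (3 * T + 1), a i) ^ 4 * W T) → (∀ T₀ : ℕ, 1 ≤ T₀ → ∀ B : ℕ, ∑ j ∈ Finset.range B, W (22 ^ j * T₀) ≤ κ * a (T₀ - 1)) → ∃ ε : ℝ, 0 < ε ∧ ∃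 C : ℝ, ∀ T : ℕ, 1 ≤ T → a T ≤ C * (T : ℝ) ^ (-ε) := by
  intro a W Cbig κ ha hmono hC hκ hW hrec hwin
  -- the number of windows `B`, the exponent `ε := 1/(100B)`, the constant `A := 2 a 0`
  obtain ⟨B, hB1, hB⟩ : ∃ B : ℕ, 1 ≤ B ∧ 4 * 9 ^ 4 * Cbig * κ ≤ (B : ℝ) :=
    ⟨⌈4 * 9 ^ 4 * Cbig * κ⌉₊ + 1, by omega, by
      push_cast; linarith [Nat.le_ceil (4 * 9 ^ 4 * Cbig * κ)]⟩
  have hBr : (1 : ℝ) ≤ B := by exact_mod_cast hB1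
  obtain ⟨ε, hε⟩ : ∃ ε : ℝ, ε = 1 / (100 * B) := ⟨_, rfl⟩
  have hε0 : 0 < ε := by rw [hε]; positivity
  have hεB : ε * B = 1 / 100 := by rw [hε]; field_simp
  have hε1 : ε ≤ 1 / 2 := by nlinarith
  have hA : a 0 ≤ 2 * a 0 := by linarith [ha 0]
  have hA0 : (0 : ℝ) ≤ 2 * a 0 := by linarith [ha 0]
  refine ⟨ε, hε0, 2 * a 0, ?_⟩
  -- the scale `b := 22^B` and the loss factor `u := (b²)^(-ε) = 22^(-1/50)`
  obtain ⟨b, hbB⟩ : ∃ b : ℕ, 22 ^ B = b := ⟨_, rfl⟩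
  have hb1 : 1 < b := by rw [← hbB]; exact Nat.one_lt_pow (by omega) (by norm_num)
  have hbr : ((b : ℕ) : ℝ) = (22 : ℝ) ^ B := by rw [← hbB]; norm_num
  obtain ⟨u, hu⟩ : ∃ u : ℝ, u = (((b : ℕ) : ℝ) ^ 2) ^ (-ε) := ⟨_, rfl⟩
  have hu0 : 0 ≤ u := by rw [hu]; positivity
  have hu5 : 1 / 2 ≤ u ^ 5 := by
    rw [hu, hbr, ← pow_mul, ← Real.rpow_natCast_mul (by norm_num),
      ← Real.rpow_mul_natCast (by norm_num)]
    apply kpDecay_num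
    push_cast
    nlinarith
  have hbase : 1 / 2 ≤ ((b : ℕ) : ℝ) ^ (-ε) := by
    rw [hbr, ← Real.rpow_natCast_mul (by norm_num)]
    apply kpDecay_num
    nlinarith
  -- `P(s) : a(b^s) ≤ A · (b^(s+1))^(-ε)` by strong induction on `s`
  have hP : ∀ s : ℕ, a (b ^ s) ≤ 2 * a 0 * ((b ^ (s + 1) : ℕ) : ℝ) ^ (-ε) := by
    intro s
    induction s using Nat.strong_induction_on with
    | _ s ih =>
      cases s with
      | zero =>
        rw [pow_zero, zero_add, pow_one]
        have h := mul_le_mul_of_nonneg_left hbase (ha 0).le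
        calc a 1 ≤ a 0 := hmono zero_le_one
          _ ≤ 2 * a 0 * ((b : ℕ) : ℝ) ^ (-ε) := by linarith
      | succ r =>
        have IH := kpDecay_allT hmono hb1 hA0 hε0.le ih
        have step := kpDecay_step ha hmono hC hκ hW hrec hwin hbB hB1 hB hε0 hε1 hA hu0 hu5 IH
        refine step.trans (le_of_eq ?_)
        have e : ((b ^ (r + 1 + 1) : ℕ) : ℝ) = ((b : ℕ) : ℝ) ^ 2 * ((b ^ r : ℕ) : ℝ) := by
          push_cast; ring
        rw [e, Real.mul_rpow (by positivity) (by positivity), hu]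
        ring
  intro T hT
  exact kpDecay_allT hmono hb1 hA0 hε0.le (fun r _ => hP r) T hT (Nat.lt_pow_self hb1)

end Summit.CriticalPhenomena.SAWScalingLimit.Theorems.HexConjecture.RootLocality

end
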